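import Literature.NumberTheory.EllipticCurves.ZpExtensionEisensteinLocalUnramifiedReadoutProofs
import Literature.NumberTheory.GaloisRepresentations.UnramifiedSubgroupMapSurjective
import Literature.NumberTheory.EllipticCurves.PeriodIndexSupportProofs
import Literature.NumberTheory.EllipticCurves.KodairaNeronUnramifiedInertiaProofs
import Literature.NumberTheory.EllipticCurves.SelmerInertia
import Literature.NumberTheory.EllipticCurves.SelmerFiniteProofs
import HarnessLib

/-!
# The readout of the unramified condition at a good place `v ∤ p` SPLIT COMPLETELY in `K_∞/K` lies in the local
# condition of `Sel_{p^∞}(E/K_∞)` (proofs file, part 3 of the `v ∤ p` clause)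

Topic `NumberTheory/EllipticCurves` (cell `pub/bsd-print-x9`, blueprint HOME/p2/S1-DISCRETE-CONTROL §2 «v ∤ p»; sequel to
`ZpExtensionEisensteinLocalUnramifiedReadoutProofs` / `ZpExtensionEisensteinReadoutUnramifiedProofs` (the finitely decomposed
places) and `PeriodIndexSupportProofs` (Milne, ADT I.3.8: `H¹(K_v^{nr}/K_v, E) = 0` at a good place, the tree's PROVED
`Milne2006_unramifiedClass_eq_zero_holds`)). THEOREMS ONLY; no definition, no named fact, no instance, no `sorry`.

* **`WeierstrassCurve.eisensteinTowerReadout_mem_localKerOver_of_decomp_le`** — let `v` be a finite place of good reduction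
  for `E = W_K` whose decomposition group lies in `H = ker κ = Gal(K̄/K_∞)` (i.e. `v` splits completely in `K_∞/K`; for the
  anticyclotomic `ℤ_p`-extension of an imaginary quadratic `K`: the primes inert in `K/ℚ`). If the localisation at `v` of
  `c ∈ H¹(K, T^{(k)})` (`T^{(k)} = E[p^{k+1}] ⊗ A_{m,k+1}(ψ⁻¹)`) is UNRAMIFIED, then the readout of `[c] ∈ H¹(K, A_𝔮)` in
  `H¹(K_∞, E[p^∞])` lies in `localKerOver p H K_v`, the local condition of `Sel_{p^∞}(E/K_∞)` at the place above `v`.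
  Proof: on `Γ_{K_v}` the twist is trivial (`χ(D_v) = 1`), so `y ↦ (ι λ y ∈ E[p^∞] ⊆ E(K̄) → E(K̄_v))` is a `Γ_{K_v}`-map
  `Ψ : T^{(k)}|_{Γ_{K_v}} → E(K̄_v)`; an unramified class has a representative `z` vanishing on `I_{K_v}` (tree
  `exists_vanishing_absInertia_of_mem_unramifiedSubgroup`), `Ψ ∘ z` vanishes on `I_{K_v} = I_𝔐` (`inertia_eq_absInertia`), so
  `[Ψ ∘ z] = 0` in `H¹(K_v, E)` by Milne I.3.8; unwinding, the readout cocycle is principal on `H_{K_v} = Γ_{K_v}`.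

This is the `v ∤ p`, split-completely clause of binder (B4) of the discrete half of the shared μ-crux's `stub_controlGlue`.

References: [MilneADT2006] Ch. I Prop. 3.8; [GreenbergLNM1716] §2 Prop. 2.1 (Im κ_η = 0 for η ∤ p) and pp. 69–72;
[Howard2004HeegnerKolyvagin] Def. 2.1.10, Lemma 2.2.7 / Prop. 2.2.8. BSD is not proved by any of this.
-/

noncomputable section

open scoped Classical ContRepresentation

open NumberField IsDedekindDomain Field
open Literature.NumberTheory.EllipticCurves Literature.NumberTheory.GaloisRepresentations
open Literature.NumberTheory.GaloisRepresentations.galoisCohomology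
open Literature.NumberTheory.GaloisCohomology.Howard2004
open Literature.NumberTheory.EllipticCurves.GreenbergSelmer
open IwasawaAlgebra IwasawaAlgebra.EisensteinCoeff

namespace WeierstrassCurve

open Literature.NumberTheory.EllipticCurves.ZpExtension (EisensteinLevel)

variable {K : Type} [Field K] [NumberField K] (W : WeierstrassCurve ℚ) [W.IsElliptic] {p : ℕ} [hp : Fact p.Prime]
  (κ : ZpExtension K p) {m : ℕ} (hm : 1 ≤ m)

variable (π : IwasawaAlgebra p ⧸ Ideal.span {(PowerSeries.X ^ m + PowerSeries.C (p : ℤ_[p]) : IwasawaAlgebra p)})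
  (e : ℕ → ℕ)
  (hkill : letI := IwasawaAlgebra.isLocalRing_quotient_X_pow_add_C p hm
    ∀ k, ∀ r ∈ IsLocalRing.maximalIdeal
      (IwasawaAlgebra p ⧸ Ideal.span {(PowerSeries.X ^ m + PowerSeries.C (p : ℤ_[p]) : IwasawaAlgebra p)}) ^ e k,
      ∀ x : EisensteinLevel p m (fun j ↦ geomTorsion (W.baseChange K) ((p : ℤ) ^ j)) (k + 1), r • x = 0)
  (hker : letI := IwasawaAlgebra.isLocalRing_quotient_X_pow_add_C p hm
    ∀ k, LinearMap.ker ((W.eisensteinTower (κ.unitTwist (-1)) hm).red k) =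
      (IsLocalRing.maximalIdeal
        (IwasawaAlgebra p ⧸ Ideal.span {(PowerSeries.X ^ m + PowerSeries.C (p : ℤ_[p]) : IwasawaAlgebra p)}) ^ e k) •
        (⊤ : Submodule (IwasawaAlgebra p ⧸ Ideal.span {(PowerSeries.X ^ m + PowerSeries.C (p : ℤ_[p]) : IwasawaAlgebra p)})
          (EisensteinLevel p m (fun j ↦ geomTorsion (W.baseChange K) ((p : ℤ) ^ j)) (k + 1 + 1))))
  (hπ : letI := IwasawaAlgebra.isLocalRing_quotient_X_pow_add_C p hm
    π ∈ IsLocalRing.maximalIdeal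
      (IwasawaAlgebra p ⧸ Ideal.span {(PowerSeries.X ^ m + PowerSeries.C (p : ℤ_[p]) : IwasawaAlgebra p)}))
  (he : ∀ k, e k ≤ e (k + 1))
  (hπX : π = Ideal.Quotient.mk _ PowerSeries.X) (hek : ∀ k, e (k + 1) - e k = m)

set_option maxHeartbeats 800000 in
/-- **(B4) at a good `v ∤ p` split completely in `K_∞/K`: unramified ⇒ the local condition of `Sel_{p^∞}(E/K_∞)`.**
For `D_v ≤ ker κ`, `E = W_K` with good reduction at `v`, and `c ∈ H¹(K, T^{(k)})` unramified at `v`, the readout of `[c]` in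
`H¹(K_∞, E[p^∞])` lies in `localKerOver p (ker κ) K_v` (dies in `H¹(H_{K_v}, E(K̄_v))`, `H_{K_v} = Γ_{K_v}`), by Milne's
`H¹(K_v^{nr}/K_v, E(K_v^{nr})) = 0`. [cite: MilneADT2006, Ch. I Prop. 3.8] [cite: GreenbergLNM1716, §2 Prop. 2.1 (Im κ_η = 0, η ∤ p)]
[cite: Howard2004HeegnerKolyvagin, Def. 2.1.10] -/
theorem eisensteinTowerReadout_mem_localKerOver_of_decomp_le (v : HeightOneSpectrum (𝓞 K))
    (hgood : (W.baseChange K).HasGoodReductionAt v) (hD : decomp (K := K) v ≤ κ.kerSubgroup) (k : ℕ)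
    (c : galoisCohomology
      ((κ.unitTwist (-1)).eisensteinTwist ((W.baseChange K).torsionGaloisModule ((p : ℤ) ^ (k + 1))) hm (k + 1)) 1)
    (hc : galoisCohomology.localization
        ((κ.unitTwist (-1)).eisensteinTwist ((W.baseChange K).torsionGaloisModule ((p : ℤ) ^ (k + 1))) hm (k + 1))
        (Sum.inr v) 1 c ∈
      DiscreteGaloisModule.unramifiedSubgroup (GaloisRep.toLocal v
        ((κ.unitTwist (-1)).eisensteinTwist ((W.baseChange K).torsionGaloisModule ((p : ℤ) ^ (k + 1))) hm (k + 1))) 1) :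
    letI := IwasawaAlgebra.isLocalRing_quotient_X_pow_add_C p hm
    W.eisensteinTowerReadout κ hm π e hkill hker hπ he hπX hek
        (AddCommGroup.DirectLimit.of _ _ k c :
          AdicTower.H1A (W.eisensteinTower (κ.unitTwist (-1)) hm) π e hkill hker hπ he) ∈
      (W.baseChange K).localKerOver p κ.kerSubgroup (v.adicCompletion K) := by
  letI := IwasawaAlgebra.isLocalRing_quotient_X_pow_add_C p hm
  obtain ⟨ξ, rfl⟩ := oneCocycleClass_surjective _ c
  -- every element of `Γ_{K_v}` restricts into `ker κ`
  have hkerv : ∀ τ : absoluteGaloisGroup (v.adicCompletion K),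
      absGaloisRestrict K (v.adicCompletion K) τ ∈ κ.kerSubgroup :=
    fun τ ↦ hD ((mem_decomp_iff v _).2 ⟨τ, rfl⟩)
  -- (1) the readout map `Ψ = pointsMap ∘ ι ∘ λ : T^{(k)} → E(K̄_v)`, `Γ_{K_v}`-equivariant since the twist is trivial on `D_v`
  obtain ⟨ψ, hψapply⟩ : ∃ ψ : Twisted p m (k + 1) (geomTorsion (W.baseChange K) ((p : ℤ) ^ (k + 1))) →+
      localPoints (W.baseChange K) (v.adicCompletion K), ∀ y,
      ψ y = pointsMap (W.baseChange K) (v.adicCompletion K)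
        ((AddSubgroup.inclusion (AcSigned.geomTorsion_zpow_le_geomPrimaryTorsion (W.baseChange K) p (k + 1))
          (Twisted.tailReadout p hm (k + 1) ((W.baseChange K).geomTorsion_pow_nsmul_eq_zero p (k + 1)) y) :
            (W.baseChange K).geomPrimaryTorsion p) : geomPoints (W.baseChange K)) :=
    ⟨(pointsMap (W.baseChange K) (v.adicCompletion K)).comp
      (((W.baseChange K).geomPrimaryTorsion p).subtype.comp
        ((AddSubgroup.inclusion (AcSigned.geomTorsion_zpow_le_geomPrimaryTorsion (W.baseChange K) p (k + 1))).comp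
          (Twisted.tailReadout p hm (k + 1) ((W.baseChange K).geomTorsion_pow_nsmul_eq_zero p (k + 1))))),
      fun _ ↦ rfl⟩
  have hψ : ∀ (τ : absoluteGaloisGroup (v.adicCompletion K))
      (y : Twisted p m (k + 1) (geomTorsion (W.baseChange K) ((p : ℤ) ^ (k + 1)))),
      ψ (GaloisRep.toLocal v ((κ.unitTwist (-1)).eisensteinTwist
        ((W.baseChange K).torsionGaloisModule ((p : ℤ) ^ (k + 1))) hm (k + 1)) τ y) = τ • ψ y := by
    intro τ y
    rw [hψapply, hψapply, (W.baseChange K).tailReadout_toLocal_apply_of_mem_kerSubgroup κ hm v (k + 1) (hkerv τ)]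
    exact pointsMap_smul (W.baseChange K) (v.adicCompletion K) τ _
  obtain ⟨Ψ, hΨapply⟩ : ∃ Ψ : DiscreteGaloisModule.toTopRep (GaloisRep.toLocal v ((κ.unitTwist (-1)).eisensteinTwist
        ((W.baseChange K).torsionGaloisModule ((p : ℤ) ^ (k + 1))) hm (k + 1))) ⟶
      discreteTopRep (absoluteGaloisGroup (v.adicCompletion K)) (localPoints (W.baseChange K) (v.adicCompletion K)),
      ∀ (z : contOneCocycles (DiscreteGaloisModule.toTopRep (GaloisRep.toLocal v ((κ.unitTwist (-1)).eisensteinTwist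
        ((W.baseChange K).torsionGaloisModule ((p : ℤ) ^ (k + 1))) hm (k + 1)))))
        (τ : absoluteGaloisGroup (v.adicCompletion K)),
        (contOneCocycles.pullback (ContinuousMonoidHom.id _) Ψ z).1 τ = ψ (z.1 τ) :=
    ⟨TopRep.ofHom ⟨⟨ψ.toIntLinearMap, continuous_of_discreteTopology⟩,
      fun τ ↦ ContinuousLinearMap.ext fun y ↦ hψ τ y⟩, fun _ _ ↦ rfl⟩
  -- (2) the localised cocycle `ξ ∘ res` on `Γ_{K_v}` and an `I_{K_v}`-VANISHING representative `z` of its class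
  obtain ⟨ξres, hξres, hξval⟩ : ∃ ξres : contOneCocycles (DiscreteGaloisModule.toTopRep (GaloisRep.toLocal v
      ((κ.unitTwist (-1)).eisensteinTwist ((W.baseChange K).torsionGaloisModule ((p : ℤ) ^ (k + 1))) hm (k + 1)))),
      (oneCocycleClass _ ξres : galoisCohomology (GaloisRep.toLocal v ((κ.unitTwist (-1)).eisensteinTwist
        ((W.baseChange K).torsionGaloisModule ((p : ℤ) ^ (k + 1))) hm (k + 1))) 1) = galoisCohomology.localization
        ((κ.unitTwist (-1)).eisensteinTwist ((W.baseChange K).torsionGaloisModule ((p : ℤ) ^ (k + 1))) hm (k + 1))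
        (Sum.inr v) 1 (oneCocycleClass _ ξ) ∧
      ∀ τ : absoluteGaloisGroup (v.adicCompletion K), ξres.1 τ = ξ.1 (absGaloisRestrict K (v.adicCompletion K) τ) :=
    ⟨contOneCocycles.pullback (absGaloisRestrict K (v.adicCompletion K))
      (X := ((κ.unitTwist (-1)).eisensteinTwist ((W.baseChange K).torsionGaloisModule ((p : ℤ) ^ (k + 1))) hm
        (k + 1)).toTopRep)
      (Y := DiscreteGaloisModule.toTopRep (GaloisRep.toLocal v ((κ.unitTwist (-1)).eisensteinTwist
        ((W.baseChange K).torsionGaloisModule ((p : ℤ) ^ (k + 1))) hm (k + 1))))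
      (TopRep.ofHom ⟨ContinuousLinearMap.id ℤ _, fun _ ↦ rfl⟩) ξ,
     (galoisCohomology.pullback_one_oneCocycleClass _ _ ξ).symm, fun _ ↦ rfl⟩
  have hc' : oneCocycleClass _ ξres ∈ DiscreteGaloisModule.unramifiedSubgroup (GaloisRep.toLocal v
      ((κ.unitTwist (-1)).eisensteinTwist ((W.baseChange K).torsionGaloisModule ((p : ℤ) ^ (k + 1))) hm (k + 1))) 1 := by
    rw [hξres]; exact hc
  obtain ⟨z, hz, hzI⟩ := DiscreteGaloisModule.exists_vanishing_absInertia_of_mem_unramifiedSubgroup _ hc'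
  rw [← sub_eq_zero, ← oneCocycleClass_sub, oneCocycleClass_eq_zero_iff] at hz
  obtain ⟨u, hu⟩ := hz
  -- (3) Milne: `[Ψ ∘ z] = 0` in `H¹(K_v, E(K̄_v))`
  obtain ⟨𝔐, h𝔐⟩ := v.localPrimesAbove_nonempty
  obtain ⟨ν, hν⟩ := v.exists_spectralValuation
  have hMilne := Milne2006_unramifiedClass_eq_zero_holds (W.baseChange K) v hgood h𝔐
    (contOneCocycles.pullback (ContinuousMonoidHom.id _) Ψ z) fun σ hσ ↦ by
      rw [IsDedekindDomain.HeightOneSpectrum.inertia_eq_absInertia hν h𝔐] at hσ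
      rw [hΨapply, show z.1 σ = 0 from hzI ⟨σ, hσ⟩, map_zero]
  rw [oneCocycleClass_eq_zero_iff] at hMilne
  obtain ⟨n₁, hn₁⟩ := hMilne
  -- (4) hence the readout of `ξ ∘ res` is principal on all of `Γ_{K_v}`
  have key : ∀ τ : absoluteGaloisGroup (v.adicCompletion K),
      pointsMap (W.baseChange K) (v.adicCompletion K)
        ((AddSubgroup.inclusion (AcSigned.geomTorsion_zpow_le_geomPrimaryTorsion (W.baseChange K) p (k + 1))
          (Twisted.tailReadout p hm (k + 1) ((W.baseChange K).geomTorsion_pow_nsmul_eq_zero p (k + 1))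
            (ξ.1 (absGaloisRestrict K (v.adicCompletion K) τ))) :
            (W.baseChange K).geomPrimaryTorsion p) : geomPoints (W.baseChange K)) = τ • (n₁ - ψ u) - (n₁ - ψ u) := by
    intro τ
    have h1 : ξ.1 (absGaloisRestrict K (v.adicCompletion K) τ) = z.1 τ -
        (GaloisRep.toLocal v ((κ.unitTwist (-1)).eisensteinTwist
          ((W.baseChange K).torsionGaloisModule ((p : ℤ) ^ (k + 1))) hm (k + 1)) τ u - u) := by
      have h := hu τ
      change z.1 τ - ξres.1 τ = GaloisRep.toLocal v ((κ.unitTwist (-1)).eisensteinTwist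
        ((W.baseChange K).torsionGaloisModule ((p : ℤ) ^ (k + 1))) hm (k + 1)) τ u - u at h
      rw [hξval] at h
      rw [← h, sub_sub_cancel]
    have h2 : ψ (z.1 τ) = τ • n₁ - n₁ := by rw [← hΨapply z τ]; exact hn₁ τ
    rw [← hψapply, h1, map_sub, map_sub, h2, hψ τ u, smul_sub]
    abel
  -- (5) the readout class on explicit cocycles; the principal criterion for `localResOver`
  obtain ⟨φ, hφ⟩ := (κ.unitTwist (-1)).exists_coordCocycles hm (k + 1)
    ((κ.unitTwist (-1)).eisensteinTwistChar hm (k + 1)) ((W.baseChange K).torsionGaloisModule ((p : ℤ) ^ (k + 1)))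
    (fun σ y ↦ (κ.unitTwist (-1)).eisensteinTwist_torsionGaloisModule_apply hm (k + 1) (W.baseChange K) _ σ y) κ
    (fun b ↦ (W.baseChange K).geomTorsion_pow_nsmul_eq_zero p (k + 1) b)
    (fun _ hσ ↦ κ.eisensteinTwistChar_unitTwist_eq_one_of_mem_kerSubgroup hm (k + 1) (-1) hσ) ξ
  have hlast : m - 1 < m := Nat.sub_lt (lt_of_lt_of_le zero_lt_one hm) zero_lt_one
  rw [WeierstrassCurve.mem_localKerOver_iff, WeierstrassCurve.eisensteinTowerReadout, ZpExtension.eisensteinTowerReadout_of,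
    ZpExtension.eisensteinTowerLevelMap_apply, map_zsmul,
    (κ.unitTwist (-1)).eisensteinTwistLevelReadout_oneCocycleClass hm (k + 1) _ _ _ κ _ _ ξ φ hφ, resH1Hom_oneCocycleClass]
  refine (congrArg (fun y ↦ ((-1 : ℤ) ^ k) • y) ?_).trans (zsmul_zero _)
  -- `localResOver = resH1Hom (resGalSubgroupOfEmb H ι) (pointsMapOfEmb ι ∘ subtype)` (definitionally, `ι = closureEmb K_v`)
  refine (CocycleCriteria.resH1Hom_oneCocycleClass_eq_zero_iff
    (resGalSubgroupOfEmb κ.kerSubgroup (closureEmb (K := K) (v.adicCompletion K)))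
    ((pointsMapOfEmb (W.baseChange K) (closureEmb (K := K) (v.adicCompletion K))).comp
      ((W.baseChange K).geomPrimaryTorsion p).subtype) _ _).2 ⟨n₁ - ψ u, fun x ↦ ?_⟩
  rw [pullback_resHomOfEquivariant_apply]
  change pointsMapOfEmb (W.baseChange K) (closureEmb (K := K) (v.adicCompletion K))
    ((AddSubgroup.inclusion (AcSigned.geomTorsion_zpow_le_geomPrimaryTorsion (W.baseChange K) p (k + 1))
      ((φ ⟨m - 1, hlast⟩).1 (resGalSubgroupOfEmb κ.kerSubgroup (closureEmb (K := K) (v.adicCompletion K)) x)) :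
        (W.baseChange K).geomPrimaryTorsion p) : geomPoints (W.baseChange K)) = _
  rw [hφ, ← ZpExtension.tailReadout_eq_tailReadout_dualFamily_last_smul hm (k + 1)
    ((W.baseChange K).geomTorsion_pow_nsmul_eq_zero p (k + 1))]
  exact key x

end WeierstrassCurve
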